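import Mathlib
import Literature.Computability.AlgebraicComplexity.HessianAtOrigin
import Literature.Algebra.Polynomial.JacobianCriterion
import Summits.ValiantsHypothesis.ValiantsHypothesis.Theorems.GrenetZeonTwoDimCoefficientsUnitCase
import Summits.ValiantsHypothesis.ValiantsHypothesis.Theorems.GrenetZeonTwoDimCoefficientsScalingShadowFactor

/-!
# Crux `GrenetZeon.TwoDimCoefficients` (stmt-ValiantsHypothesis-8062), stub `stub_dualUnipotent`:
# scaling-closure — RAY INTERPOLATION of Hessian rank bounds (factor programme, bricks L3/L4)

The shadow `Φ = c + β⁻¹·per_n + Σ_k Ψ_k` of a unipotent dual representation and its irreducible factors are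
sums of FORMS (`Ψ_k` homogeneous of degree `k·n`).  Along a ray `t ↦ t·z` the Hessian of a sum of forms is
a matrix polynomial in `t`: `Hess(Σ_e Ψ_e)(t·z) = Σ_e t^{deg Ψ_e − 2}·Hess Ψ_e(z)` (`hess0_transl_smul_of_isHomogeneous`,
`hess0_transl_smul_sum`).  If this matrix polynomial has rank `≤ ρ` at nodes `t_i` (the zeros of the factor on
the ray, where Mignon–Ressayre applies — ✓ `rank_hess0_factor_le_of_dualUnipotent` for simple factors) whose
generalized Vandermonde matrix `(t_i^{deg Ψ_e − 2})_{i,e}` has a left inverse, then EVERY linear combination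
of the `Hess Ψ_e(z)` has rank `≤ #nodes · ρ` — not `#forms · #nodes · ρ`: all `Hess Ψ_e(z)` lie in the column
span of the node matrices (`rank_sum_smul_le_of_nodes`, ★ `rank_sum_smul_hess0_le_of_rayNodes`).

This is the column-space count (L3/L4) of the 17th hand's factor programme (memo SEVENTEENTH-HAND.md): with
`#nodes = #forms of the factor ≤ (degree budget)/n` it turns per-factor Mignon–Ressayre bounds into
`n² = rank Hess per_n ≤ (m/n)·(2m + 3)`, i.e. the 3/2 rung, for pencils with `deg D_k ≤ k·n` — modulo the
factor lemma for MULTIPLE factors (L1′, open).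

HONEST FRAMING: generic linear algebra plus homogeneity bookkeeping; the stub `DualUnipotentBound`, the crux
and `VP ≠ VNP` remain open.

References: folklore (Lagrange interpolation of matrix polynomials; Euler homogeneity).
-/

-- single-conjunct layout `Summits/ValiantsHypothesis/ValiantsHypothesis`: the duplicated namespace
-- component is mandated by the tree.
set_option linter.dupNamespace false
set_option autoImplicit false

noncomputable section

namespace Summit.ValiantsHypothesis.ValiantsHypothesis.Theorems.GrenetZeonTwoDimCoefficients.ScalingClosure

open MvPolynomial Matrix
open Literature.Computability.AlgebraicComplexity
open Summit.ValiantsHypothesis.ValiantsHypothesis.Cruxes.TwoDimCoefficients.DimTwoCases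

/-! ### Linear algebra: combinations of matrices interpolated from low-rank nodes -/

section LinAlg

variable {K : Type*} [Field K] {σ : Type*} [Fintype σ] [DecidableEq σ]

omit [DecidableEq σ] in
/-- Rank is subadditive over finite sums. [folklore] -/
theorem rank_finset_sum_le {ι : Type*} (s : Finset ι) (M : ι → Matrix σ σ K) :
    (∑ i ∈ s, M i).rank ≤ ∑ i ∈ s, (M i).rank := by
  classical
  induction s using Finset.induction_on with
  | empty => simp
  | insert a s ha ih =>
    rw [Finset.sum_insert ha, Finset.sum_insert ha]
    exact (rank_add_le_rank_add _ _).trans (by omega)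

/-- ★ **Interpolation bound.**  If the node combinations `N_i = Σ_e V_{ie}·H_e` have rank `≤ ρ` and the node
matrix `V` has a left inverse `W` (`W·V = 1`), then every combination `Σ_e a_e·H_e` has rank `≤ #I·ρ`: indeed
`H_e = Σ_i W_{ei}·N_i`, so all `H_e` lie in the span of the columns of the `N_i`. [folklore] -/
theorem rank_sum_smul_le_of_nodes {E I : Type*} [Fintype E] [Fintype I] [DecidableEq E]
    (H : E → Matrix σ σ K) (V : Matrix I E K) (W : Matrix E I K) (hWV : W * V = 1) (ρ : ℕ)
    (hnodes : ∀ i, (∑ e, V i e • H e).rank ≤ ρ) (a : E → K) :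
    (∑ e, a e • H e).rank ≤ Fintype.card I * ρ := by
  -- `H e = Σ_i W e i • N i`
  have hH : ∀ e, H e = ∑ i, W e i • ∑ e', V i e' • H e' := by
    intro e
    simp_rw [Finset.smul_sum, smul_smul]
    rw [Finset.sum_comm]
    simp_rw [← Finset.sum_smul, ← Matrix.mul_apply, hWV, Matrix.one_apply, ite_smul, one_smul, zero_smul,
      Finset.sum_ite_eq, Finset.mem_univ, if_true]
  have hsum : ∑ e, a e • H e = ∑ i, (∑ e, a e * W e i) • ∑ e', V i e' • H e' := by
    conv_lhs => rw [show (fun e => a e • H e) = fun e => ∑ i, (a e * W e i) • ∑ e', V i e' • H e' from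
      funext fun e => by rw [hH e, Finset.smul_sum]; simp_rw [smul_smul]]
    rw [Finset.sum_comm]
    simp_rw [← Finset.sum_smul]
  rw [hsum]
  refine (rank_finset_sum_le _ _).trans ?_
  calc ∑ i, ((∑ e, a e * W e i) • ∑ e', V i e' • H e').rank ≤ ∑ _i : I, ρ :=
        Finset.sum_le_sum fun i _ => (rank_smul_le _ _).trans (hnodes i)
    _ = Fintype.card I * ρ := by rw [Finset.sum_const, Finset.card_univ, smul_eq_mul]

end LinAlg

/-! ### Hessians of forms along rays -/

section Ray

variable {σ : Type*} [Fintype σ]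

/-- **Euler along rays for the Hessian**: for a form `Ψ` of degree `e`,
`Hess Ψ(t·z) = t^{e−2}·Hess Ψ(z)` (natural-number exponent; both sides vanish for `e ≤ 1`). [folklore] -/
theorem hess0_transl_smul_of_isHomogeneous (Ψ : MvPolynomial σ ℂ) {e : ℕ} (hΨ : Ψ.IsHomogeneous e)
    (t : ℂ) (z : σ → ℂ) :
    hess0 (transl (t • z) Ψ) = t ^ (e - 2) • hess0 (transl z Ψ) := by
  ext s u
  have hh : (pderiv s (pderiv u Ψ)).IsHomogeneous (e - 2) := by
    have h := Literature.Algebra.Polynomial.JacobianCriterion.isHomogeneous_pderiv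
      (Literature.Algebra.Polynomial.JacobianCriterion.isHomogeneous_pderiv hΨ u) s
    rwa [show e - 1 - 1 = e - 2 by omega] at h
  rw [hess0_transl, Matrix.smul_apply, hess0_transl, smul_eq_mul, eval_smul_of_isHomogeneous _ hh t z]

/-- The Hessian of a sum of forms along a ray is a matrix polynomial in the ray parameter:
`Hess(Σ_e Ψ_e)(t·z) = Σ_e t^{deg Ψ_e − 2}·Hess Ψ_e(z)`. [folklore] -/
theorem hess0_transl_smul_sum {E : Type*} (s : Finset E) (Ψ : E → MvPolynomial σ ℂ) (d : E → ℕ)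
    (hΨ : ∀ e ∈ s, (Ψ e).IsHomogeneous (d e)) (t : ℂ) (z : σ → ℂ) :
    hess0 (transl (t • z) (∑ e ∈ s, Ψ e)) = ∑ e ∈ s, t ^ (d e - 2) • hess0 (transl z (Ψ e)) := by
  rw [map_sum, map_sum]
  exact Finset.sum_congr rfl fun e he => hess0_transl_smul_of_isHomogeneous (Ψ e) (hΨ e he) t z

omit [Fintype σ] in
/-- A constant shift does not change the Hessian: `Hess(c + G)(x) = Hess G(x)`. [folklore] -/
theorem hess0_transl_C_add (c : ℂ) (G : MvPolynomial σ ℂ) (x : σ → ℂ) :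
    hess0 (transl x (MvPolynomial.C c + G)) = hess0 (transl x G) := by
  rw [map_add, map_add, transl_C, hess0_eq_zero_of_totalDegree_le_one ((totalDegree_C c).le.trans zero_le_one),
    zero_add]

variable [DecidableEq σ]

/-- ★ **Ray interpolation of Hessian rank bounds.**  Let `G = c + Σ_{e ∈ E} Ψ_e` with `Ψ_e` a form of degree
`d_e`, and let `t_i` (`i ∈ I`) be ray parameters at which `rank Hess G(t_i·z) ≤ ρ` (e.g. the zeros of `G` on the
ray `t ↦ t·z`, by a Mignon–Ressayre-type bound).  If the generalized Vandermonde matrix `V_{ie} = t_i^{d_e − 2}` has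
a left inverse, then every combination `Σ_e a_e·Hess Ψ_e(z)` — in particular each `Hess Ψ_e(z)` and the Hessian
of any polynomial expression's linearisation in the `Ψ_e` — has rank `≤ #I·ρ`. [folklore] -/
theorem rank_sum_smul_hess0_le_of_rayNodes {E I : Type*} [Fintype E] [Fintype I] [DecidableEq E] (c : ℂ)
    (Ψ : E → MvPolynomial σ ℂ) (d : E → ℕ) (hΨ : ∀ e, (Ψ e).IsHomogeneous (d e)) (z : σ → ℂ)
    (t : I → ℂ) (ρ : ℕ)
    (hnodes : ∀ i, (hess0 (transl (t i • z) (MvPolynomial.C c + ∑ e, Ψ e))).rank ≤ ρ)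
    (W : Matrix E I ℂ) (hWV : W * (Matrix.of fun (i : I) (e : E) => t i ^ (d e - 2)) = 1) (a : E → ℂ) :
    (∑ e, a e • hess0 (transl z (Ψ e))).rank ≤ Fintype.card I * ρ := by
  refine rank_sum_smul_le_of_nodes (fun e => hess0 (transl z (Ψ e)))
    (Matrix.of fun (i : I) (e : E) => t i ^ (d e - 2)) W hWV ρ (fun i => ?_) a
  have h := hnodes i
  rw [hess0_transl_C_add, hess0_transl_smul_sum Finset.univ Ψ d (fun e _ => hΨ e) (t i) z] at h
  simpa only [Matrix.of_apply] using h

/-- **Single form.**  In the same situation each individual `Hess Ψ_e(z)` has rank `≤ #I·ρ`. [folklore] -/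
theorem rank_hess0_le_of_rayNodes {E I : Type*} [Fintype E] [Fintype I] [DecidableEq E] (c : ℂ)
    (Ψ : E → MvPolynomial σ ℂ) (d : E → ℕ) (hΨ : ∀ e, (Ψ e).IsHomogeneous (d e)) (z : σ → ℂ)
    (t : I → ℂ) (ρ : ℕ)
    (hnodes : ∀ i, (hess0 (transl (t i • z) (MvPolynomial.C c + ∑ e, Ψ e))).rank ≤ ρ)
    (W : Matrix E I ℂ) (hWV : W * (Matrix.of fun (i : I) (e : E) => t i ^ (d e - 2)) = 1) (e₀ : E) :
    (hess0 (transl z (Ψ e₀))).rank ≤ Fintype.card I * ρ := by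
  have h := rank_sum_smul_hess0_le_of_rayNodes c Ψ d hΨ z t ρ hnodes W hWV (Pi.single e₀ 1)
  rwa [Fintype.sum_eq_single e₀ (fun e he => by rw [Pi.single_eq_of_ne he, zero_smul]), Pi.single_eq_same,
    one_smul] at h

end Ray

end Summit.ValiantsHypothesis.ValiantsHypothesis.Theorems.GrenetZeonTwoDimCoefficients.ScalingClosure

end
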